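import Summits.HodgeConjecture.CorCM.ImaginaryQuadraticTimesNonGaloisQuarticCMHodge
import Summits.HodgeConjecture.CorCM.ImaginaryQuadraticTimesCyclicCMHodge
import Summits.HodgeConjecture.CorCM.QuarticCMTypeSliceBiquadratic
import Literature.AlgebraicGeometry.ComplexMultiplication.SimpleIffPrimitiveCMType
import HarnessLib

/-!
# `E^a × S^b` for a CM elliptic curve `E` and a SIMPLE CM abelian surface `S`: `B• = D•` and the Hodge conjecture,
# unconditionally

COR-CM (cell `pub-hodgecm2`, seat p2 gen 16, count-neutral claim IQD4 (3/3)); NEW as stated, hence under `Summits/`.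
The union of the CYCLIC file `CorCM/ImaginaryQuadraticTimesCyclicCMHodge` (seat b23) and the DIHEDRAL file
`CorCM/ImaginaryQuadraticTimesNonGaloisQuarticCMHodge` (this seat), keyed on the SURFACE rather than on the Galois
type of its field.  A quartic CM field `K` is cyclic Galois, biquadratic Galois, or not Galois over `ℚ`; by
`CorCM/QuarticCMTypeSliceBiquadratic` (seat b24: in exponent `2` no translate of `{a, a ∘ h}` separates `a` from
`a ∘ h`) a biquadratic `K` carries NO primitive CM type, so:

* §1 **`QuarticCM.isCyclic_of_isPrimitive`** — a quartic CM field, Galois over `ℚ`, with a PRIMITIVE CM type has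
  cyclic Galois group; hence for the two-slot family `(K_{i₀}, K_{i₁})` (`K_{i₀}` imaginary quadratic, `K_{i₁}` quartic
  CM with a primitive type `Φ_{i₁}`) the cyclic or the dihedral file applies:
* §2 `slotwiseIndependent_of_quadratic_of_isPrimitive`, `isNondegenerateFamily_of_quadratic_of_isPrimitive`,
  `hodgeClassSpan_prod_eq_divisorClassesSpan_of_quadratic_of_isPrimitive`,
  **`hodgeConjectureFor_prod_of_quadratic_of_isPrimitive`**; and, reading primitivity off ONE simple realisation
  (Shimura §8.2 Prop. 26, `ComplexMultiplication.isSimple_iff_isPrimitive`),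
  `hodgeClassSpan_prod_eq_divisorClassesSpan_of_quadratic_of_isSimple`, `not_exists_exceptional_prod_of_quadratic_of_isSimple`,
  **`hodgeConjectureFor_prod_of_quadratic_of_isSimple`**: `Bᵐ ⊗ ℂ = Dᵐ ⊗ ℂ` and the Hodge conjecture on EVERY
  `E^a × S^b` — every product `⨁_{j<N} A_{π j}` of realisations — for `E` a CM elliptic curve (any imaginary quadratic
  field) and `S` a SIMPLE abelian surface with complex multiplication by a quartic CM field (any field, any type),
  with NO named fact.

(Non-simple CM abelian surfaces are isogenous to products of CM elliptic curves; `E^a × S^b` is then dominated by a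
product of elliptic curves, for which the tree has `HodgeTheory/EllipticCurvesProductsHodgeClassesOfRiemann` — not
combined here.)  Everything is a short application; theorems only; no definition, no `sorry`.

## References

* [Gordon1999HodgeAVSurvey] B. B. Gordon, *A survey of the Hodge conjecture for abelian varieties*, §3 Theorem (Imai,
  Murty) with proof; 7.5; 10.10.
* [Shimura1998] G. Shimura, *Abelian Varieties with Complex Multiplication and Modular Functions*, §8.2 Prop. 26,
  §8.4 (2).
* [MoonenZarhin1999LowDim] B. Moonen, Yu. Zarhin, Math. Ann. 315 (1999) 711–733, section "Hodge groups of simple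
  abelian surfaces of CM-type".
-/

noncomputable section

open CategoryTheory CategoryTheory.Limits NumberField NumberField.ComplexEmbedding IntermediateField

/-! ## §1 A Galois quartic CM field with a primitive CM type is cyclic -/

namespace Summit.HodgeConjecture.CorCM.QuarticCM

open Literature.NumberTheory.ComplexMultiplication
open Literature.AlgebraicGeometry.Motives (CMType)
open Literature.AlgebraicGeometry.Pohlmann1968

variable {K : Type} [Field K] [NumberField K] [IsCMField K]

/-- **A quartic CM field that is Galois over `ℚ` and carries a PRIMITIVE CM type has CYCLIC Galois group**: were the
group non-cyclic (exponent `2`), `Φ = {a, a ∘ h}` with `h² = 1`, and no translate of `Φ` separates `a` from `a ∘ h`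
(`forall_smul_mem_iff_of_mul_self_eq_one`), against Kubota's criterion `isPrimitive_iff_forall_eq`.  Equivalently: a
biquadratic CM field has no primitive CM type (its abelian surfaces split). [cite: Shimura1998, §8.4 (2)] -/
theorem isCyclic_of_isPrimitive [IsGalois ℚ K] (h4 : Module.finrank ℚ K = 4) {Φ : CMType K} {φ₀ : K →+* ℂ}
    (hprim : IsPrimitive (ℂ ≃+* ℂ) Φ.1 φ₀) : IsCyclic (K ≃ₐ[ℚ] K) := by
  by_contra hK
  obtain ⟨a, b, hba, hba', hΦ⟩ := exists_mem_mem_ne h4 Φ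
  obtain ⟨h, hb⟩ := exists_eq_comp_algEquiv a b
  have hh : h * h = 1 := mul_self_eq_one_of_not_isCyclic h4 hK h
  have hΦ' : ∀ s, s ∈ Φ.1 ↔ s = a ∨ s = a.comp h.toRingEquiv.toRingHom := fun s => by rw [hΦ s, hb]
  haveI := isPretransitive_ringEquiv_complex (K := K)
  have hsep : a = b := (isPrimitive_iff_forall_eq Φ.1 φ₀).1 hprim a b fun τ => by
    rw [hb]
    exact forall_smul_mem_iff_of_mul_self_eq_one hh hΦ' τ
  exact hba hsep.symm

/-- For a quartic CM field a primitive CM type is nondegenerate (Ribet's bound in degree `≤ 6`,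
`Pohlmann1968.isNondegenerate_of_isPrimitive_of_finrank_le_six`). [cite: Shimura1998, §8.4 (2)] -/
theorem isNondegenerate_of_isPrimitive (h4 : Module.finrank ℚ K = 4) (Φ : CMType K) {φ₀ : K →+* ℂ}
    (hprim : IsPrimitive (ℂ ≃+* ℂ) Φ.1 φ₀) : IsNondegenerate Φ :=
  isNondegenerate_of_isPrimitive_of_finrank_le_six Φ (by rw [h4]; norm_num) φ₀ hprim

end Summit.HodgeConjecture.CorCM.QuarticCM

/-! ## §2 The two-slot family `(k, K)`, `K` quartic with a primitive type / a simple realisation -/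

namespace Summit.HodgeConjecture.CorCM

open Literature.NumberTheory.ComplexMultiplication
open Literature.AlgebraicGeometry.Motives (AbelianVariety CMType)
open Literature.AlgebraicGeometry.HodgeTheory
open Literature.AlgebraicGeometry.ComplexMultiplication (IsCMTypeRealisation isSimple_iff_isPrimitive)
open Literature.AlgebraicGeometry.VanGeemen1994 (hodgeClassSpan)
open Literature.AlgebraicGeometry.Pohlmann1968
open Literature.Barriers.HodgeConjecture (divisorClassesSpan)

section TwoSlots

variable {I : Type} {K : I → Type} [∀ i, Field (K i)] [∀ i, NumberField (K i)] [∀ i, IsCMField (K i)] [Fintype I]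
  [Nonempty I] {Φ : ∀ i, CMType (K i)}

omit [Nonempty I] in
/-- **Slotwise independence for `(k, K)`, `K` quartic CM with a primitive type**: `K` Galois ⟹ cyclic (§1) and the
cyclic file applies; `K` not Galois ⟹ the dihedral file applies. [cite: Gordon1999HodgeAVSurvey, §3 Theorem (proof)] -/
theorem slotwiseIndependent_of_quadratic_of_isPrimitive {i₀ i₁ : I} (h01 : i₀ ≠ i₁) (hI : ∀ j, j = i₀ ∨ j = i₁)
    (h0 : Module.finrank ℚ (K i₀) = 2) (h4 : Module.finrank ℚ (K i₁) = 4) {φ₀ : K i₁ →+* ℂ}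
    (hprim : IsPrimitive (ℂ ≃+* ℂ) (Φ i₁).1 φ₀) : SlotwiseIndependent (ℂ ≃+* ℂ) fun i => K i →+* ℂ := by
  by_cases hG : IsGalois ℚ (K i₁)
  · haveI := QuarticCM.isCyclic_of_isPrimitive h4 hprim
    exact slotwiseIndependent_of_quadratic_of_cyclic h01 hI h0 (dvd_of_eq h4.symm)
  · exact slotwiseIndependent_of_quadratic_of_not_isGalois hI h0 h4 hG

/-- **Every family of types `(Φ_{i₀}, Φ_{i₁})` with `Φ_{i₁}` primitive is nondegenerate** (`E × S` is stably
nondegenerate). [cite: Gordon1999HodgeAVSurvey, §3 Theorem and 7.5] -/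
theorem isNondegenerateFamily_of_quadratic_of_isPrimitive {i₀ i₁ : I} (h01 : i₀ ≠ i₁) (hI : ∀ j, j = i₀ ∨ j = i₁)
    (h0 : Module.finrank ℚ (K i₀) = 2) (h4 : Module.finrank ℚ (K i₁) = 4) {φ₀ : K i₁ →+* ℂ}
    (hprim : IsPrimitive (ℂ ≃+* ℂ) (Φ i₁).1 φ₀) : CMAlgebra.IsNondegenerateFamily Φ := by
  refine (isNondegenerateFamily_iff_forall_isNondegenerate
    (slotwiseIndependent_of_quadratic_of_isPrimitive h01 hI h0 h4 hprim) Φ).2 fun i => ?_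
  rcases hI i with rfl | rfl
  · exact isNondegenerate_of_finrank_eq_two (Φ _) h0
  · exact QuarticCM.isNondegenerate_of_isPrimitive h4 (Φ _) hprim

variable {A : I → AbelianVariety ℂ} {ι : ∀ i, 𝓞 (K i) →+* End (A i)}
  {θ : ∀ i, K i →+* Module.End ℂ (complexBetti (A i).X 1)}

/-- **`Bᵐ ⊗ ℂ = Dᵐ ⊗ ℂ` on every `E^a × S^b`**, `S` a realisation of a PRIMITIVE type of a quartic CM field.
[cite: Gordon1999HodgeAVSurvey, §3 Theorem (2) and 7.5] -/
theorem hodgeClassSpan_prod_eq_divisorClassesSpan_of_quadratic_of_isPrimitive {i₀ i₁ : I} (h01 : i₀ ≠ i₁)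
    (hI : ∀ j, j = i₀ ∨ j = i₁) (h0 : Module.finrank ℚ (K i₀) = 2) (h4 : Module.finrank ℚ (K i₁) = 4)
    {φ₀ : K i₁ →+* ℂ} (hprim : IsPrimitive (ℂ ≃+* ℂ) (Φ i₁).1 φ₀)
    (hA : ∀ i, IsCMTypeRealisation (Φ i) (A i) (ι i) (θ i)) {N : ℕ} (π : Fin N → I) (m : ℕ) :
    hodgeClassSpan (⨁ fun j : Fin N => A (π j)).dim (⨁ fun j : Fin N => A (π j)).X m =
      divisorClassesSpan (⨁ fun j : Fin N => A (π j)).X (⨁ fun j : Fin N => A (π j)).dim m :=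
  (isNondegenerateFamily_of_quadratic_of_isPrimitive h01 hI h0 h4 hprim).hodgeClassSpan_prod_eq_divisorClassesSpan
    hA π m

/-- **The Hodge conjecture for every `E^a × S^b`**, `E` a CM elliptic curve, `S` a realisation of a PRIMITIVE CM type
of a quartic CM field (any field: cyclic ⟹ b23's file, non-Galois ⟹ the dihedral file, biquadratic ⟹ no primitive
type), UNCONDITIONAL. [cite: Gordon1999HodgeAVSurvey, §3 Theorem and 10.10] [cite: Shimura1998, §8.4 (2)] -/
theorem hodgeConjectureFor_prod_of_quadratic_of_isPrimitive {i₀ i₁ : I} (h01 : i₀ ≠ i₁) (hI : ∀ j, j = i₀ ∨ j = i₁)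
    (h0 : Module.finrank ℚ (K i₀) = 2) (h4 : Module.finrank ℚ (K i₁) = 4) {φ₀ : K i₁ →+* ℂ}
    (hprim : IsPrimitive (ℂ ≃+* ℂ) (Φ i₁).1 φ₀) (hA : ∀ i, IsCMTypeRealisation (Φ i) (A i) (ι i) (θ i)) {N : ℕ}
    (π : Fin N → I) : HodgeConjectureFor (⨁ fun j : Fin N => A (π j)).dim (⨁ fun j : Fin N => A (π j)).X :=
  (isNondegenerateFamily_of_quadratic_of_isPrimitive h01 hI h0 h4 hprim).hodgeConjectureFor_prod hA π

/-- **`Bᵐ ⊗ ℂ = Dᵐ ⊗ ℂ` on every `E^a × S^b` for a SIMPLE CM abelian surface `S`** (primitivity read off the simple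
realisation `A_{i₁}`, Shimura §8.2 Prop. 26). [cite: Shimura1998, §8.2 Prop. 26] [cite: Gordon1999HodgeAVSurvey, §3 Theorem (2)] -/
theorem hodgeClassSpan_prod_eq_divisorClassesSpan_of_quadratic_of_isSimple {i₀ i₁ : I} (h01 : i₀ ≠ i₁)
    (hI : ∀ j, j = i₀ ∨ j = i₁) (h0 : Module.finrank ℚ (K i₀) = 2) (h4 : Module.finrank ℚ (K i₁) = 4)
    (hA : ∀ i, IsCMTypeRealisation (Φ i) (A i) (ι i) (θ i)) (hS : (A i₁).IsSimple) {N : ℕ} (π : Fin N → I)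
    (m : ℕ) :
    hodgeClassSpan (⨁ fun j : Fin N => A (π j)).dim (⨁ fun j : Fin N => A (π j)).X m =
      divisorClassesSpan (⨁ fun j : Fin N => A (π j)).X (⨁ fun j : Fin N => A (π j)).dim m := by
  obtain ⟨φ₀⟩ : Nonempty (K i₁ →+* ℂ) := inferInstance
  exact hodgeClassSpan_prod_eq_divisorClassesSpan_of_quadratic_of_isPrimitive h01 hI h0 h4
    ((isSimple_iff_isPrimitive (hA i₁) φ₀).1 hS) hA π m

/-- **No `E^a × S^b` with `S` a simple CM abelian surface supports an exotic Hodge class.**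
[cite: Gordon1999HodgeAVSurvey, §3 Theorem (2) and 7.5] -/
theorem not_exists_exceptional_prod_of_quadratic_of_isSimple {i₀ i₁ : I} (h01 : i₀ ≠ i₁)
    (hI : ∀ j, j = i₀ ∨ j = i₁) (h0 : Module.finrank ℚ (K i₀) = 2) (h4 : Module.finrank ℚ (K i₁) = 4)
    (hA : ∀ i, IsCMTypeRealisation (Φ i) (A i) (ι i) (θ i)) (hS : (A i₁).IsSimple) {N : ℕ} (π : Fin N → I)
    (m : ℕ) :
    ¬∃ c : complexBetti (⨁ fun j : Fin N => A (π j)).X (2 * m), IsRationalClass c ∧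
        IsOfHodgeType (⨁ fun j : Fin N => A (π j)).dim (⨁ fun j : Fin N => A (π j)).X (2 * m) m m c ∧
        c ∉ divisorClassesSpan (⨁ fun j : Fin N => A (π j)).X (⨁ fun j : Fin N => A (π j)).dim m := by
  obtain ⟨φ₀⟩ : Nonempty (K i₁ →+* ℂ) := inferInstance
  exact (isNondegenerateFamily_of_quadratic_of_isPrimitive h01 hI h0 h4
    ((isSimple_iff_isPrimitive (hA i₁) φ₀).1 hS)).not_exists_exceptional_prod hA π m

/-- **The Hodge conjecture for every `E^a × S^b` with `E` a CM elliptic curve and `S` a SIMPLE CM abelian surface**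
(every product `⨁_{j<N} A_{π j}` of the two-slot family: `K_{i₀}` imaginary quadratic, `K_{i₁}` a quartic CM field,
`A_{i₁}` a SIMPLE realisation), UNCONDITIONAL — no named fact, no hypothesis on the fields or the types beyond the
degrees. [cite: Gordon1999HodgeAVSurvey, §3 Theorem and 10.10] [cite: Shimura1998, §8.2 Prop. 26 and §8.4 (2)] -/
theorem hodgeConjectureFor_prod_of_quadratic_of_isSimple {i₀ i₁ : I} (h01 : i₀ ≠ i₁) (hI : ∀ j, j = i₀ ∨ j = i₁)
    (h0 : Module.finrank ℚ (K i₀) = 2) (h4 : Module.finrank ℚ (K i₁) = 4)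
    (hA : ∀ i, IsCMTypeRealisation (Φ i) (A i) (ι i) (θ i)) (hS : (A i₁).IsSimple) {N : ℕ} (π : Fin N → I) :
    HodgeConjectureFor (⨁ fun j : Fin N => A (π j)).dim (⨁ fun j : Fin N => A (π j)).X := by
  obtain ⟨φ₀⟩ : Nonempty (K i₁ →+* ℂ) := inferInstance
  exact hodgeConjectureFor_prod_of_quadratic_of_isPrimitive h01 hI h0 h4 ((isSimple_iff_isPrimitive (hA i₁) φ₀).1 hS)
    hA π

end TwoSlots

end Summit.HodgeConjecture.CorCM

end
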